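import Mathlib
import Summits.MatrixMultiplication.MatrixMultiplication.Theses.FourierTwoFamiliesModP
import Summits.MatrixMultiplication.MatrixMultiplication.Theorems.PrimeTwoFamilies.Negative.Slices
import Summits.MatrixMultiplication.MatrixMultiplication.Theorems.FourierTwoFamiliesModPPrimeTwoFamiliesStubWords
import Summits.MatrixMultiplication.MatrixMultiplication.Theorems.FourierTwoFamiliesModPPrimeTwoFamiliesLadderConverse
import Summits.MatrixMultiplication.MatrixMultiplication.Theorems.FourierTwoFamiliesModPPrimeTwoFamiliesStubCapacityTransfer

/-!
# `PrimeTwoFamilies ↔` the cyclic ladder conjecture — through the code form (siege k16)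

Item `stmt-MatrixMultiplication-14308` (`FourierTwoFamiliesModP.PrimeTwoFamilies`, CKSU 2005 Conj. 4.7 with
prime cyclic hosts), line `Sketch`, registered stub `primeTwoFamilies_iff_cyclicLadder` (siege k16, variation
"certificate / decide on the finite core"; the lead's proof of the same statement is
`…Theorems.PrimeTwoFamilies.LadderLift.primeTwoFamilies_iff_cyclicLadder`, this file keeps its own namespace).

A CYCLIC LADDER level is a family of `r` classes `(X c, Y c)` in `ℤ/m` with (i) every class direct and
(ii) for classes `p < q` every lower cross difference `y' - x'` (`x' ∈ X p`, `y' ∈ Y q`) distinct from every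
diagonal difference `y - x` (`x ∈ X c`, `y ∈ Y c`); the CYCLIC LADDER CONJECTURE asks, for every `ε > 0`,
for arbitrarily large `m` and such levels with `m^{1/2-ε} ≤ r` classes of co-volume `m^{1-ε} ≤ |X c||Y c|`.

## Design of this proof (certificate on the finite core)

The two skeleton generations of line `Sketch` — the LADDER form (round 1) and the CODE / capacity-gadget
form (cycle c1: a zero-error code `W ⊆ (Fin L → Fin r)` over a gadget of direct pairs, every ordered pair
of distinct words strongly separated in some coordinate) — are linked here by ONE finite combinatorial
certificate, and everything else is delegated to landed bookkeeping:

* `exists_apply_lt_of_sum_eq` — THE FINITE CORE: two distinct words `i ≠ k : Fin L → Fin r` with the same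
  digit sum have a coordinate `t` with `i t < k t`.  This coordinate is the separation certificate: by
  ladder clause (ii) at `(c, i t, k t)` the cross differences `Q (k t) - P (i t)` avoid every diagonal
  difference set, so the constant-digit-sum words form a zero-error code over the ladder read as a gadget
  (`constantSum_isCode`).  (The core quantifies over all `L, r`, so it is certified by the strict
  monotonicity of finite sums, `Finset.sum_lt_sum`, not by enumeration.)
* `words_le_card` — counting bookkeeping: with `L := ⌈2/ε⌉₊` and `m ≥ (L+1)²`, a level with
  `m^{1/2-ε/2} ≤ r` classes has a digit sum attained by `N ≥ r^L/(Lr+1) ≥ (m^L)^{1/2-ε}` words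
  (the pigeonhole itself is the landed `LadderLift.stub_words`).
* `capacityGadgets_of_cyclicLadder` — hence cyclic ladders ARE capacity gadgets (the hypothesis of the
  landed transfer `CapacityLift.stub_capacityTransfer`, which lifts the code to `(ℤ/m)^L`, moves it into a
  Bertrand prime by the carry-free transfer and keeps `n` pairs), giving every slice `0 < δ ≤ 1` of the crux,
  and the slices `δ > 1` by monotonicity (`PrimeTwoFamiliesAt.mono`).
* (⇒) is the landed neighbour stub `LadderLift.cyclicLadder_of_primeTwoFamilies` (an SDPP witness is a
  ladder in any order of its pairs).

So the (⇐) direction does not pass through the constant-sum lift `stub_lift` / `stub_bookkeeping` of the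
lead's proof: the ladder lift is recovered as the special case "constant-digit-sum code" of the code lift.
-/

-- single-conjunct summit: the mandated namespace repeats `MatrixMultiplication` (summit = sub-problem).
set_option linter.dupNamespace false

namespace Summit.MatrixMultiplication.MatrixMultiplication.Theorems.PrimeTwoFamilies.SiegeK16

open Finset
open Summit.MatrixMultiplication.MatrixMultiplication.Theses
open Summit.MatrixMultiplication.MatrixMultiplication.Theorems.PrimeTwoFamilies.Negative
open Summit.MatrixMultiplication.MatrixMultiplication.Theorems.PrimeTwoFamilies.LadderLift
open Summit.MatrixMultiplication.MatrixMultiplication.Theorems.PrimeTwoFamilies.CapacityLift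

/-! ## The finite core: the separation certificate of the constant-digit-sum code -/

/-- **Finite core (separation certificate).**  Two distinct words `i ≠ k : Fin L → Fin r` with the same
digit sum have a coordinate `t` at which `i t < k t` (otherwise `k ≤ i` pointwise with a strict
coordinate, and the digit sum of `k` would be strictly smaller). -/
theorem exists_apply_lt_of_sum_eq {L r : ℕ} {i k : Fin L → Fin r} (hik : i ≠ k)
    (hsum : ∑ t, ((i t : ℕ)) = ∑ t, ((k t : ℕ))) : ∃ t : Fin L, i t < k t := by
  by_contra h
  push Not at h
  obtain ⟨t₀, ht₀⟩ : ∃ t₀, i t₀ ≠ k t₀ := by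
    by_contra h'
    push Not at h'
    exact hik (funext h')
  have hlt : ∑ t, ((k t : ℕ)) < ∑ t, ((i t : ℕ)) :=
    Finset.sum_lt_sum (fun t _ => Fin.le_iff_val_le_val.1 (h t))
      ⟨t₀, Finset.mem_univ _, Fin.lt_def.1 (lt_of_le_of_ne (h t₀) (Ne.symm ht₀))⟩
  omega

/-- **The constant-digit-sum words are a zero-error code over a ladder.**  If the classes `(X c, Y c)`
satisfy ladder clause (ii) (lower cross differences, `p < q`, avoid all diagonal differences), then any
two distinct words of digit sum `S` are strongly separated at the certificate coordinate of
`exists_apply_lt_of_sum_eq`. -/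
theorem constantSum_isCode {K : Type*} [AddCommGroup K] {r L : ℕ} (X Y : Fin r → Finset K)
    (hL : ∀ c p q : Fin r, p < q → ∀ x ∈ X c, ∀ y ∈ Y c, ∀ x' ∈ X p, ∀ y' ∈ Y q, y - x ≠ y' - x')
    (S : ℕ) :
    ∀ i ∈ (Finset.univ.filter (fun w : Fin L → Fin r => ∑ t, ((w t : ℕ)) = S)),
      ∀ k ∈ (Finset.univ.filter (fun w : Fin L → Fin r => ∑ t, ((w t : ℕ)) = S)), i ≠ k →
        ∃ t : Fin L, ∀ x ∈ X (i t), ∀ y ∈ Y (k t), ∀ c : Fin r, ∀ x' ∈ X c, ∀ y' ∈ Y c,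
          y - x ≠ y' - x' := by
  intro i hi k hk hik
  simp only [Finset.mem_filter, Finset.mem_univ, true_and] at hi hk
  obtain ⟨t, ht⟩ := exists_apply_lt_of_sum_eq hik (hi.trans hk.symm)
  exact ⟨t, fun x hx y hy c x' hx' y' hy' h => hL c (i t) (k t) ht x' hx' y' hy' x hx y hy h.symm⟩

/-! ## Counting bookkeeping -/

/-- **Word-count bookkeeping.**  For `ε > 0` put `L := ⌈2/ε⌉₊` (so `1 ≤ L`).  For every level
`m ≥ (L+1)²`, every class count `r` with `m^{1/2-ε/2} ≤ r` and every `N` with `r^L ≤ (L r + 1) N`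
(the popular digit sum of `stub_words`) one has `(m^L)^{1/2-ε} ≤ N`:
`(m^L)^{1/2-ε} (L r + 1) ≤ m^{L(1/2-ε)} (L+1) r ≤ m^{L(1/2-ε)+1/2} r ≤ m^{(1/2-ε/2)(L-1)} r ≤ r^L`. -/
theorem words_le_card {ε : ℝ} (hε : 0 < ε) :
    ∃ L : ℕ, 1 ≤ L ∧ ∃ m₁ : ℕ, ∀ m : ℕ, m₁ ≤ m → ∀ r : ℕ, (m : ℝ) ^ (1 / 2 - ε / 2) ≤ (r : ℝ) →
      ∀ N : ℕ, r ^ L ≤ (L * r + 1) * N → ((m : ℝ) ^ (L : ℝ)) ^ (1 / 2 - ε) ≤ (N : ℝ) := by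
  set L : ℕ := ⌈2 / ε⌉₊ with hLdef
  have hLε : 2 / ε ≤ (L : ℝ) := Nat.le_ceil _
  have hLε' : 2 ≤ (L : ℝ) * ε := by
    have := (div_le_iff₀ hε).1 hLε
    linarith
  have hL1 : 1 ≤ L := by
    have h0 : (0 : ℝ) < L := lt_of_lt_of_le (div_pos two_pos hε) hLε
    have h0' : 0 < L := by exact_mod_cast h0
    exact h0'
  refine ⟨L, hL1, (L + 1) ^ 2, fun m hm r hr N hN => ?_⟩
  -- basic positivity
  have hm1 : (1 : ℝ) ≤ m := by
    have : 1 ≤ (L + 1) ^ 2 := Nat.one_le_pow _ _ (Nat.succ_pos _)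
    exact_mod_cast this.trans hm
  have hm0 : (0 : ℝ) < m := one_pos.trans_le hm1
  have hθ0 : (0 : ℝ) < (m : ℝ) ^ (1 / 2 - ε / 2) := Real.rpow_pos_of_pos hm0 _
  have hr0 : (0 : ℝ) < r := hθ0.trans_le hr
  have hr1 : (1 : ℝ) ≤ r := by
    have : 0 < r := by exact_mod_cast hr0
    exact_mod_cast this
  -- `L + 1 ≤ m ^ (1/2)`
  have hLm : (L : ℝ) + 1 ≤ (m : ℝ) ^ (1 / 2 : ℝ) := by
    have hsq : ((L : ℝ) + 1) ^ (2 : ℝ) ≤ (m : ℝ) := by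
      rw [Real.rpow_two]
      exact_mod_cast hm
    calc (L : ℝ) + 1 = (((L : ℝ) + 1) ^ (2 : ℝ)) ^ (1 / 2 : ℝ) := by
          rw [← Real.rpow_mul (by positivity)]; norm_num
      _ ≤ (m : ℝ) ^ (1 / 2 : ℝ) := Real.rpow_le_rpow (by positivity) hsq (by norm_num)
  -- the exponent comparison `L (1/2 - ε) + 1/2 ≤ (1/2 - ε/2) (L - 1)`
  have hexp : (L : ℝ) * (1 / 2 - ε) + 1 / 2 ≤ (1 / 2 - ε / 2) * ((L : ℝ) - 1) := by
    nlinarith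
  -- `m ^ ((1/2 - ε/2) (L - 1)) ≤ r ^ (L - 1)`
  have hpow : (m : ℝ) ^ ((1 / 2 - ε / 2) * ((L : ℝ) - 1)) ≤ (r : ℝ) ^ (L - 1) := by
    have h1 : (m : ℝ) ^ ((1 / 2 - ε / 2) * ((L : ℝ) - 1)) = ((m : ℝ) ^ (1 / 2 - ε / 2)) ^ (L - 1) := by
      rw [Real.rpow_mul hm0.le, ← Real.rpow_natCast]
      push_cast [Nat.cast_sub hL1]
      ring_nf
    rw [h1]
    exact pow_le_pow_left₀ hθ0.le hr (L - 1)
  -- the chain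
  have key : ((m : ℝ) ^ (L : ℝ)) ^ (1 / 2 - ε) * ((L : ℝ) * r + 1) ≤ (r : ℝ) ^ L := by
    calc ((m : ℝ) ^ (L : ℝ)) ^ (1 / 2 - ε) * ((L : ℝ) * r + 1)
        = (m : ℝ) ^ ((L : ℝ) * (1 / 2 - ε)) * ((L : ℝ) * r + 1) := by
          rw [Real.rpow_mul hm0.le]
      _ ≤ (m : ℝ) ^ ((L : ℝ) * (1 / 2 - ε)) * (((L : ℝ) + 1) * r) := by
          refine mul_le_mul_of_nonneg_left ?_ (Real.rpow_nonneg hm0.le _)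
          nlinarith
      _ ≤ (m : ℝ) ^ ((L : ℝ) * (1 / 2 - ε)) * ((m : ℝ) ^ (1 / 2 : ℝ) * r) := by
          refine mul_le_mul_of_nonneg_left ?_ (Real.rpow_nonneg hm0.le _)
          exact mul_le_mul_of_nonneg_right hLm hr0.le
      _ = (m : ℝ) ^ ((L : ℝ) * (1 / 2 - ε) + 1 / 2) * r := by
          rw [Real.rpow_add hm0]; ring
      _ ≤ (m : ℝ) ^ ((1 / 2 - ε / 2) * ((L : ℝ) - 1)) * r := by
          refine mul_le_mul_of_nonneg_right ?_ hr0.le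
          exact Real.rpow_le_rpow_of_exponent_le hm1 hexp
      _ ≤ (r : ℝ) ^ (L - 1) * r := mul_le_mul_of_nonneg_right hpow hr0.le
      _ = (r : ℝ) ^ L := by
          rw [← pow_succ, Nat.sub_add_cancel hL1]
  have hN' : (r : ℝ) ^ L ≤ ((L : ℝ) * r + 1) * N := by exact_mod_cast hN
  have hpos : (0 : ℝ) < (L : ℝ) * r + 1 := by positivity
  refine le_of_mul_le_mul_right ?_ hpos
  calc ((m : ℝ) ^ (L : ℝ)) ^ (1 / 2 - ε) * ((L : ℝ) * r + 1) ≤ (r : ℝ) ^ L := key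
    _ ≤ ((L : ℝ) * r + 1) * N := hN'
    _ = (N : ℝ) * ((L : ℝ) * r + 1) := by ring

/-! ## Cyclic ladders are capacity gadgets -/

/-- **Cyclic ladders are capacity gadgets.**  From the cyclic ladder conjecture one gets, for every
`ε > 0` and arbitrarily large `m`, a gadget of direct pairs in `ℤ/m` of co-volume `≥ m^{1-ε}` together with
a zero-error code of length `L ≥ 1` and size `≥ (m^L)^{1/2-ε}`: the gadget is a ladder level at `ε/2`
(taken above the threshold of `words_le_card`), the code is the set of words of the popular digit sum
(`stub_words`), separated by the finite core (`constantSum_isCode`). -/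
theorem capacityGadgets_of_cyclicLadder
    (hC : ∀ ε : ℝ, 0 < ε → ∀ m₀ : ℕ, ∃ m ≥ m₀, ∃ r : ℕ, ∃ X Y : Fin r → Finset (ZMod m),
      ((∀ c : Fin r, ∀ x ∈ X c, ∀ x' ∈ X c, ∀ y ∈ Y c, ∀ y' ∈ Y c,
          (x - x') + (y - y') = 0 → x = x' ∧ y = y') ∧
        (∀ c p q : Fin r, p < q → ∀ x ∈ X c, ∀ y ∈ Y c, ∀ x' ∈ X p, ∀ y' ∈ Y q,
          y - x ≠ y' - x')) ∧
      (m : ℝ) ^ (1 / 2 - ε) ≤ (r : ℝ) ∧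
      ∀ c : Fin r, (m : ℝ) ^ (1 - ε) ≤ (((X c).card * (Y c).card : ℕ) : ℝ)) :
    ∀ ε : ℝ, 0 < ε → ∀ m₀ : ℕ, ∃ m ≥ m₀, ∃ r L : ℕ, ∃ P Q : Fin r → Finset (ZMod m),
      ∃ W : Finset (Fin L → Fin r),
        (∀ c : Fin r, ∀ x ∈ P c, ∀ x' ∈ P c, ∀ y ∈ Q c, ∀ y' ∈ Q c,
            (x - x') + (y - y') = 0 → x = x' ∧ y = y') ∧
        (∀ i ∈ W, ∀ k ∈ W, i ≠ k → ∃ t : Fin L,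
            ∀ x ∈ P (i t), ∀ y ∈ Q (k t), ∀ c : Fin r, ∀ x' ∈ P c, ∀ y' ∈ Q c, y - x ≠ y' - x') ∧
        1 ≤ L ∧ ((m : ℝ) ^ (L : ℝ)) ^ (1 / 2 - ε) ≤ (W.card : ℝ) ∧
        ∀ c : Fin r, (m : ℝ) ^ (1 - ε) ≤ (((P c).card * (Q c).card : ℕ) : ℝ) := by
  intro ε hε m₀
  obtain ⟨L, hL1, m₁, hm₁⟩ := words_le_card hε
  obtain ⟨m, hm, r, X, Y, ⟨hW, hLad⟩, hr, hP⟩ := hC (ε / 2) (half_pos hε) (max m₀ (max m₁ 1))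
  obtain ⟨S, hS⟩ := stub_words r L
  have hm₀m : m₀ ≤ m := le_trans (le_max_left _ _) hm
  have hm₁m : m₁ ≤ m := le_trans ((le_max_left _ _).trans (le_max_right _ _)) hm
  have hm1 : (1 : ℝ) ≤ m := by
    exact_mod_cast le_trans ((le_max_right _ _).trans (le_max_right _ _)) hm
  refine ⟨m, hm₀m, r, L, X, Y,
    Finset.univ.filter (fun w : Fin L → Fin r => ∑ t, ((w t : ℕ)) = S),
    hW, constantSum_isCode X Y hLad S, hL1, hm₁ m hm₁m r hr _ hS, fun c => ?_⟩
  exact (Real.rpow_le_rpow_of_exponent_le hm1 (by linarith)).trans (hP c)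

/-! ## The registered stub -/

/-- **`PrimeTwoFamilies ↔` the cyclic ladder conjecture** (registered stub
`primeTwoFamilies_iff_cyclicLadder` of crux stmt-MatrixMultiplication-14308, line `Sketch`): CKSU
Conj. 4.7 with prime cyclic hosts holds iff for every `ε > 0` there are arbitrarily large `m` and
ordered escape ladders in `ZMod m` — (i) every class direct, (ii) lower cross differences (`p < q`)
avoiding all diagonal differences — with `m^{1/2-ε} ≤ r` classes of co-volume `m^{1-ε} ≤ |X c||Y c|`.
(⇒) the landed converse `cyclicLadder_of_primeTwoFamilies` (an SDPP witness is a ladder in any order);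
(⇐) ladders are capacity gadgets via the constant-digit-sum code (`capacityGadgets_of_cyclicLadder`,
finite core `exists_apply_lt_of_sum_eq`), capacity gadgets give every slice `0 < δ ≤ 1`
(`stub_capacityTransfer`), and slices are monotone in `δ`. -/
theorem primeTwoFamilies_iff_cyclicLadder :
    FourierTwoFamiliesModP.PrimeTwoFamilies ↔
    (∀ ε : ℝ, 0 < ε → ∀ m₀ : ℕ, ∃ m ≥ m₀, ∃ r : ℕ, ∃ X Y : Fin r → Finset (ZMod m),
      ((∀ c : Fin r, ∀ x ∈ X c, ∀ x' ∈ X c, ∀ y ∈ Y c, ∀ y' ∈ Y c,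
          (x - x') + (y - y') = 0 → x = x' ∧ y = y') ∧
        (∀ c p q : Fin r, p < q → ∀ x ∈ X c, ∀ y ∈ Y c, ∀ x' ∈ X p, ∀ y' ∈ Y q,
          y - x ≠ y' - x')) ∧
      (m : ℝ) ^ (1 / 2 - ε) ≤ (r : ℝ) ∧
      ∀ c : Fin r, (m : ℝ) ^ (1 - ε) ≤ (((X c).card * (Y c).card : ℕ) : ℝ)) := by
  refine ⟨cyclicLadder_of_primeTwoFamilies, fun hC => ?_⟩
  have hCap := capacityGadgets_of_cyclicLadder hC
  rw [primeTwoFamilies_iff]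
  intro δ hδ
  by_cases h1 : δ ≤ 1
  · exact stub_capacityTransfer hCap hδ h1
  · exact (stub_capacityTransfer hCap one_pos le_rfl).mono (le_of_not_ge h1)

end Summit.MatrixMultiplication.MatrixMultiplication.Theorems.PrimeTwoFamilies.SiegeK16
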